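import Summits.Ventures.PercRepro.RankLevelSetRuleQConvThirtyFiveData

/-!
# PercRepro — the depth-35 Gauss convergent of the master sum `S(q,m)` as a sub-solution of its recurrence, certified by
Kronecker polynomial identity testing (p4, gen 27; C-044; paper proofs/P4-CELL-THREE.md §13.3, §13.6)

`C_35 = cfThirtyFiveN / cfThirtyFiveD` is the depth-35 convergent of the Gauss continued fraction of `S(q,m) = ₂F₁(−m,1;q+1;−1)`, reduced by its
common factor.  `cfThirtyFive_step`: it is a sub-solution of the recurrence `(q+m+1)·S(q,m+1) = 2(m+1)·S(q,m) + q` — the defect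
polynomial `cfThirtyFiveStep` (an exact polynomial identity, `cfThirtyFive_step_eq`) vanishes identically for `m < 16` and is a polynomial with
1278 non-negative coefficients in `(q − m − 1, m − 16)` beyond; `cfThirtyFiveD_pos`: the denominator is positive for `m + 1 ≤ q`
(`cfThirtyFive_D_shift`: 576 non-negative coefficients in `(q − m − 1, m)`, constant term `233769382178028593015119503815237173248000000`); `cfThirtyFive_zero`: `C_35(q,0) = 1 = S(q,0)`.
**`cfThirtyFive_le_sumS`**: `C_35(q,m) ≤ S(q,m)` for `m + 1 ≤ q`, by induction on `m`.
Every polynomial identity is ONE evaluation at a Kronecker point (`PercRepro.PIT.pitE`); every polynomial is flat data.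
No `sorry`; axioms standard.
-/

namespace PercRepro

open PIT
/-- expression (left side) of `cfThirtyFive_D_shift`. -/
def cfThirtyFiveEcfThirtyFive_D_shift : PExpr := (.comp cfThirtyFiveDData (.add (.add .va .vb) (.const (1))) .vb)

/-- expression (right side) of `cfThirtyFive_D_shift`. -/
def cfThirtyFiveFcfThirtyFive_D_shift : PExpr := (.leaf cfThirtyFiveDAb)

set_option maxHeartbeats 4000000 in
/-- `D(a + b + 1, b)` as the shifted data. -/
lemma cfThirtyFive_D_shift (a b : ℚ) : cfThirtyFiveD (a + b + 1) b = evalP a b cfThirtyFiveDAb := by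
  have h := pitE 158 54 cfThirtyFiveEcfThirtyFive_D_shift cfThirtyFiveFcfThirtyFive_D_shift (by decide +kernel) (by decide +kernel) (by decide +kernel) (by decide +kernel)
  simpa [evalE, cfThirtyFiveEcfThirtyFive_D_shift, cfThirtyFiveFcfThirtyFive_D_shift, cfThirtyFiveD] using h a b

/-- The denominator is positive for `0 ≤ m`, `m + 1 ≤ q`. -/
lemma cfThirtyFiveD_pos (q m : ℚ) (hm : 0 ≤ m) (hq : m + 1 ≤ q) : 0 < cfThirtyFiveD q m := by
  have h := cfThirtyFive_D_shift (q - m - 1) m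
  rw [show q - m - 1 + m + 1 = q by ring] at h
  rw [h]
  unfold cfThirtyFiveDAb
  exact evalP_pos cfThirtyFiveDAbRest 233769382178028593015119503815237173248000000 (by norm_num) (by decide +kernel) _ _ (by linarith) hm

/-- expression (left side) of `cfThirtyFive_zero`. -/
def cfThirtyFiveEcfThirtyFive_zero : PExpr := (.comp cfThirtyFiveNData .va (.const (0)))

/-- expression (right side) of `cfThirtyFive_zero`. -/
def cfThirtyFiveFcfThirtyFive_zero : PExpr := (.comp cfThirtyFiveDData .va (.const (0)))

set_option maxHeartbeats 4000000 in
/-- `C_35(q, 0) = 1`: numerator and denominator agree at `m = 0`. -/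
lemma cfThirtyFive_zero (q : ℚ) : cfThirtyFiveN q 0 = cfThirtyFiveD q 0 := by
  have h := pitE 151 1 cfThirtyFiveEcfThirtyFive_zero cfThirtyFiveFcfThirtyFive_zero (by decide +kernel) (by decide +kernel) (by decide +kernel) (by decide +kernel)
  simpa [evalE, cfThirtyFiveEcfThirtyFive_zero, cfThirtyFiveFcfThirtyFive_zero, cfThirtyFiveN, cfThirtyFiveD] using h q 0

/-- expression (left side) of `cfThirtyFive_step_eq`. -/
def cfThirtyFiveEcfThirtyFive_step_eq : PExpr := (.add (.mul (.add (.mul (.mul (.const (2)) (.add .vb (.const (1)))) (.leaf cfThirtyFiveNData)) (.mul .va (.leaf cfThirtyFiveDData))) (.comp cfThirtyFiveDData .va (.add .vb (.const (1))))) (.neg (.mul (.mul (.add (.add .va .vb) (.const (1))) (.comp cfThirtyFiveNData .va (.add .vb (.const (1))))) (.leaf cfThirtyFiveDData))))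

/-- expression (right side) of `cfThirtyFive_step_eq`. -/
def cfThirtyFiveFcfThirtyFive_step_eq : PExpr := (.leaf cfThirtyFiveStepData)

set_option maxHeartbeats 4000000 in
/-- The defect of the recurrence step of `C_35` is the polynomial `cfThirtyFiveStep`. -/
lemma cfThirtyFive_step_eq (q m : ℚ) : (2 * (m + 1) * cfThirtyFiveN q m + q * cfThirtyFiveD q m) * cfThirtyFiveD q (m + 1) - (q + m + 1) * cfThirtyFiveN q (m + 1) * cfThirtyFiveD q m = cfThirtyFiveStep q m := by
  have h := pitE 301 37 cfThirtyFiveEcfThirtyFive_step_eq cfThirtyFiveFcfThirtyFive_step_eq (by decide +kernel) (by decide +kernel) (by decide +kernel) (by decide +kernel)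
  have h' := h q m
  simp only [evalE, cfThirtyFiveEcfThirtyFive_step_eq, cfThirtyFiveFcfThirtyFive_step_eq, Int.cast_one, Int.cast_ofNat] at h'
  simp only [cfThirtyFiveN, cfThirtyFiveD, cfThirtyFiveStep]
  linear_combination h'

/-- expression (left side) of `cfThirtyFive_step_shift`. -/
def cfThirtyFiveEcfThirtyFive_step_shift : PExpr := (.comp cfThirtyFiveStepData (.add (.add .va .vb) (.const (17))) (.add .vb (.const (16))))

/-- expression (right side) of `cfThirtyFive_step_shift`. -/
def cfThirtyFiveFcfThirtyFive_step_shift : PExpr := (.leaf cfThirtyFiveStepAb)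

set_option maxHeartbeats 4000000 in
/-- The defect shifted to `(a, b) = (q − m − 1, m − 16)` is the non-negative data. -/
lemma cfThirtyFive_step_shift (a b : ℚ) : cfThirtyFiveStep (a + b + 17) (b + 16) = evalP a b cfThirtyFiveStepAb := by
  have h := pitE 307 72 cfThirtyFiveEcfThirtyFive_step_shift cfThirtyFiveFcfThirtyFive_step_shift (by decide +kernel) (by decide +kernel) (by decide +kernel) (by decide +kernel)
  simpa [evalE, cfThirtyFiveEcfThirtyFive_step_shift, cfThirtyFiveFcfThirtyFive_step_shift, cfThirtyFiveStep] using h a b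

/-- expression (left side) of `cfThirtyFive_step_zero0`. -/
def cfThirtyFiveEcfThirtyFive_step_zero0 : PExpr := (.comp cfThirtyFiveStepData .va (.const (0)))

/-- expression (right side) of `cfThirtyFive_step_zero0`. -/
def cfThirtyFiveFcfThirtyFive_step_zero0 : PExpr := (.leaf [])

set_option maxHeartbeats 4000000 in
/-- The defect vanishes identically at `m = 0`. -/
lemma cfThirtyFive_step_zero0 (q : ℚ) : cfThirtyFiveStep q 0 = 0 := by
  have h := pitE 1 1 cfThirtyFiveEcfThirtyFive_step_zero0 cfThirtyFiveFcfThirtyFive_step_zero0 (by decide +kernel) (by decide +kernel) (by decide +kernel) (by decide +kernel)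
  simpa [evalE, evalP, cfThirtyFiveEcfThirtyFive_step_zero0, cfThirtyFiveFcfThirtyFive_step_zero0, cfThirtyFiveStep] using h q 0

/-- expression (left side) of `cfThirtyFive_step_zero1`. -/
def cfThirtyFiveEcfThirtyFive_step_zero1 : PExpr := (.comp cfThirtyFiveStepData .va (.const (1)))

/-- expression (right side) of `cfThirtyFive_step_zero1`. -/
def cfThirtyFiveFcfThirtyFive_step_zero1 : PExpr := (.leaf [])

set_option maxHeartbeats 4000000 in
/-- The defect vanishes identically at `m = 1`. -/
lemma cfThirtyFive_step_zero1 (q : ℚ) : cfThirtyFiveStep q 1 = 0 := by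
  have h := pitE 211 1 cfThirtyFiveEcfThirtyFive_step_zero1 cfThirtyFiveFcfThirtyFive_step_zero1 (by decide +kernel) (by decide +kernel) (by decide +kernel) (by decide +kernel)
  simpa [evalE, evalP, cfThirtyFiveEcfThirtyFive_step_zero1, cfThirtyFiveFcfThirtyFive_step_zero1, cfThirtyFiveStep] using h q 0

/-- expression (left side) of `cfThirtyFive_step_zero2`. -/
def cfThirtyFiveEcfThirtyFive_step_zero2 : PExpr := (.comp cfThirtyFiveStepData .va (.const (2)))

/-- expression (right side) of `cfThirtyFive_step_zero2`. -/
def cfThirtyFiveFcfThirtyFive_step_zero2 : PExpr := (.leaf [])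

set_option maxHeartbeats 4000000 in
/-- The defect vanishes identically at `m = 2`. -/
lemma cfThirtyFive_step_zero2 (q : ℚ) : cfThirtyFiveStep q 2 = 0 := by
  have h := pitE 215 1 cfThirtyFiveEcfThirtyFive_step_zero2 cfThirtyFiveFcfThirtyFive_step_zero2 (by decide +kernel) (by decide +kernel) (by decide +kernel) (by decide +kernel)
  simpa [evalE, evalP, cfThirtyFiveEcfThirtyFive_step_zero2, cfThirtyFiveFcfThirtyFive_step_zero2, cfThirtyFiveStep] using h q 0

/-- expression (left side) of `cfThirtyFive_step_zero3`. -/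
def cfThirtyFiveEcfThirtyFive_step_zero3 : PExpr := (.comp cfThirtyFiveStepData .va (.const (3)))

/-- expression (right side) of `cfThirtyFive_step_zero3`. -/
def cfThirtyFiveFcfThirtyFive_step_zero3 : PExpr := (.leaf [])

set_option maxHeartbeats 4000000 in
/-- The defect vanishes identically at `m = 3`. -/
lemma cfThirtyFive_step_zero3 (q : ℚ) : cfThirtyFiveStep q 3 = 0 := by
  have h := pitE 219 1 cfThirtyFiveEcfThirtyFive_step_zero3 cfThirtyFiveFcfThirtyFive_step_zero3 (by decide +kernel) (by decide +kernel) (by decide +kernel) (by decide +kernel)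
  simpa [evalE, evalP, cfThirtyFiveEcfThirtyFive_step_zero3, cfThirtyFiveFcfThirtyFive_step_zero3, cfThirtyFiveStep] using h q 0

/-- expression (left side) of `cfThirtyFive_step_zero4`. -/
def cfThirtyFiveEcfThirtyFive_step_zero4 : PExpr := (.comp cfThirtyFiveStepData .va (.const (4)))

/-- expression (right side) of `cfThirtyFive_step_zero4`. -/
def cfThirtyFiveFcfThirtyFive_step_zero4 : PExpr := (.leaf [])

set_option maxHeartbeats 4000000 in
/-- The defect vanishes identically at `m = 4`. -/
lemma cfThirtyFive_step_zero4 (q : ℚ) : cfThirtyFiveStep q 4 = 0 := by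
  have h := pitE 223 1 cfThirtyFiveEcfThirtyFive_step_zero4 cfThirtyFiveFcfThirtyFive_step_zero4 (by decide +kernel) (by decide +kernel) (by decide +kernel) (by decide +kernel)
  simpa [evalE, evalP, cfThirtyFiveEcfThirtyFive_step_zero4, cfThirtyFiveFcfThirtyFive_step_zero4, cfThirtyFiveStep] using h q 0

/-- expression (left side) of `cfThirtyFive_step_zero5`. -/
def cfThirtyFiveEcfThirtyFive_step_zero5 : PExpr := (.comp cfThirtyFiveStepData .va (.const (5)))

/-- expression (right side) of `cfThirtyFive_step_zero5`. -/
def cfThirtyFiveFcfThirtyFive_step_zero5 : PExpr := (.leaf [])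

set_option maxHeartbeats 4000000 in
/-- The defect vanishes identically at `m = 5`. -/
lemma cfThirtyFive_step_zero5 (q : ℚ) : cfThirtyFiveStep q 5 = 0 := by
  have h := pitE 227 1 cfThirtyFiveEcfThirtyFive_step_zero5 cfThirtyFiveFcfThirtyFive_step_zero5 (by decide +kernel) (by decide +kernel) (by decide +kernel) (by decide +kernel)
  simpa [evalE, evalP, cfThirtyFiveEcfThirtyFive_step_zero5, cfThirtyFiveFcfThirtyFive_step_zero5, cfThirtyFiveStep] using h q 0

/-- expression (left side) of `cfThirtyFive_step_zero6`. -/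
def cfThirtyFiveEcfThirtyFive_step_zero6 : PExpr := (.comp cfThirtyFiveStepData .va (.const (6)))

/-- expression (right side) of `cfThirtyFive_step_zero6`. -/
def cfThirtyFiveFcfThirtyFive_step_zero6 : PExpr := (.leaf [])

set_option maxHeartbeats 4000000 in
/-- The defect vanishes identically at `m = 6`. -/
lemma cfThirtyFive_step_zero6 (q : ℚ) : cfThirtyFiveStep q 6 = 0 := by
  have h := pitE 231 1 cfThirtyFiveEcfThirtyFive_step_zero6 cfThirtyFiveFcfThirtyFive_step_zero6 (by decide +kernel) (by decide +kernel) (by decide +kernel) (by decide +kernel)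
  simpa [evalE, evalP, cfThirtyFiveEcfThirtyFive_step_zero6, cfThirtyFiveFcfThirtyFive_step_zero6, cfThirtyFiveStep] using h q 0

/-- expression (left side) of `cfThirtyFive_step_zero7`. -/
def cfThirtyFiveEcfThirtyFive_step_zero7 : PExpr := (.comp cfThirtyFiveStepData .va (.const (7)))

/-- expression (right side) of `cfThirtyFive_step_zero7`. -/
def cfThirtyFiveFcfThirtyFive_step_zero7 : PExpr := (.leaf [])

set_option maxHeartbeats 4000000 in
/-- The defect vanishes identically at `m = 7`. -/
lemma cfThirtyFive_step_zero7 (q : ℚ) : cfThirtyFiveStep q 7 = 0 := by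
  have h := pitE 234 1 cfThirtyFiveEcfThirtyFive_step_zero7 cfThirtyFiveFcfThirtyFive_step_zero7 (by decide +kernel) (by decide +kernel) (by decide +kernel) (by decide +kernel)
  simpa [evalE, evalP, cfThirtyFiveEcfThirtyFive_step_zero7, cfThirtyFiveFcfThirtyFive_step_zero7, cfThirtyFiveStep] using h q 0

/-- expression (left side) of `cfThirtyFive_step_zero8`. -/
def cfThirtyFiveEcfThirtyFive_step_zero8 : PExpr := (.comp cfThirtyFiveStepData .va (.const (8)))

/-- expression (right side) of `cfThirtyFive_step_zero8`. -/
def cfThirtyFiveFcfThirtyFive_step_zero8 : PExpr := (.leaf [])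

set_option maxHeartbeats 4000000 in
/-- The defect vanishes identically at `m = 8`. -/
lemma cfThirtyFive_step_zero8 (q : ℚ) : cfThirtyFiveStep q 8 = 0 := by
  have h := pitE 238 1 cfThirtyFiveEcfThirtyFive_step_zero8 cfThirtyFiveFcfThirtyFive_step_zero8 (by decide +kernel) (by decide +kernel) (by decide +kernel) (by decide +kernel)
  simpa [evalE, evalP, cfThirtyFiveEcfThirtyFive_step_zero8, cfThirtyFiveFcfThirtyFive_step_zero8, cfThirtyFiveStep] using h q 0

/-- expression (left side) of `cfThirtyFive_step_zero9`. -/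
def cfThirtyFiveEcfThirtyFive_step_zero9 : PExpr := (.comp cfThirtyFiveStepData .va (.const (9)))

/-- expression (right side) of `cfThirtyFive_step_zero9`. -/
def cfThirtyFiveFcfThirtyFive_step_zero9 : PExpr := (.leaf [])

set_option maxHeartbeats 4000000 in
/-- The defect vanishes identically at `m = 9`. -/
lemma cfThirtyFive_step_zero9 (q : ℚ) : cfThirtyFiveStep q 9 = 0 := by
  have h := pitE 241 1 cfThirtyFiveEcfThirtyFive_step_zero9 cfThirtyFiveFcfThirtyFive_step_zero9 (by decide +kernel) (by decide +kernel) (by decide +kernel) (by decide +kernel)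
  simpa [evalE, evalP, cfThirtyFiveEcfThirtyFive_step_zero9, cfThirtyFiveFcfThirtyFive_step_zero9, cfThirtyFiveStep] using h q 0

/-- expression (left side) of `cfThirtyFive_step_zero10`. -/
def cfThirtyFiveEcfThirtyFive_step_zero10 : PExpr := (.comp cfThirtyFiveStepData .va (.const (10)))

/-- expression (right side) of `cfThirtyFive_step_zero10`. -/
def cfThirtyFiveFcfThirtyFive_step_zero10 : PExpr := (.leaf [])

set_option maxHeartbeats 4000000 in
/-- The defect vanishes identically at `m = 10`. -/
lemma cfThirtyFive_step_zero10 (q : ℚ) : cfThirtyFiveStep q 10 = 0 := by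
  have h := pitE 244 1 cfThirtyFiveEcfThirtyFive_step_zero10 cfThirtyFiveFcfThirtyFive_step_zero10 (by decide +kernel) (by decide +kernel) (by decide +kernel) (by decide +kernel)
  simpa [evalE, evalP, cfThirtyFiveEcfThirtyFive_step_zero10, cfThirtyFiveFcfThirtyFive_step_zero10, cfThirtyFiveStep] using h q 0

/-- expression (left side) of `cfThirtyFive_step_zero11`. -/
def cfThirtyFiveEcfThirtyFive_step_zero11 : PExpr := (.comp cfThirtyFiveStepData .va (.const (11)))

/-- expression (right side) of `cfThirtyFive_step_zero11`. -/
def cfThirtyFiveFcfThirtyFive_step_zero11 : PExpr := (.leaf [])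

set_option maxHeartbeats 4000000 in
/-- The defect vanishes identically at `m = 11`. -/
lemma cfThirtyFive_step_zero11 (q : ℚ) : cfThirtyFiveStep q 11 = 0 := by
  have h := pitE 247 1 cfThirtyFiveEcfThirtyFive_step_zero11 cfThirtyFiveFcfThirtyFive_step_zero11 (by decide +kernel) (by decide +kernel) (by decide +kernel) (by decide +kernel)
  simpa [evalE, evalP, cfThirtyFiveEcfThirtyFive_step_zero11, cfThirtyFiveFcfThirtyFive_step_zero11, cfThirtyFiveStep] using h q 0

/-- expression (left side) of `cfThirtyFive_step_zero12`. -/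
def cfThirtyFiveEcfThirtyFive_step_zero12 : PExpr := (.comp cfThirtyFiveStepData .va (.const (12)))

/-- expression (right side) of `cfThirtyFive_step_zero12`. -/
def cfThirtyFiveFcfThirtyFive_step_zero12 : PExpr := (.leaf [])

set_option maxHeartbeats 4000000 in
/-- The defect vanishes identically at `m = 12`. -/
lemma cfThirtyFive_step_zero12 (q : ℚ) : cfThirtyFiveStep q 12 = 0 := by
  have h := pitE 250 1 cfThirtyFiveEcfThirtyFive_step_zero12 cfThirtyFiveFcfThirtyFive_step_zero12 (by decide +kernel) (by decide +kernel) (by decide +kernel) (by decide +kernel)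
  simpa [evalE, evalP, cfThirtyFiveEcfThirtyFive_step_zero12, cfThirtyFiveFcfThirtyFive_step_zero12, cfThirtyFiveStep] using h q 0

/-- expression (left side) of `cfThirtyFive_step_zero13`. -/
def cfThirtyFiveEcfThirtyFive_step_zero13 : PExpr := (.comp cfThirtyFiveStepData .va (.const (13)))

/-- expression (right side) of `cfThirtyFive_step_zero13`. -/
def cfThirtyFiveFcfThirtyFive_step_zero13 : PExpr := (.leaf [])

set_option maxHeartbeats 4000000 in
/-- The defect vanishes identically at `m = 13`. -/
lemma cfThirtyFive_step_zero13 (q : ℚ) : cfThirtyFiveStep q 13 = 0 := by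
  have h := pitE 253 1 cfThirtyFiveEcfThirtyFive_step_zero13 cfThirtyFiveFcfThirtyFive_step_zero13 (by decide +kernel) (by decide +kernel) (by decide +kernel) (by decide +kernel)
  simpa [evalE, evalP, cfThirtyFiveEcfThirtyFive_step_zero13, cfThirtyFiveFcfThirtyFive_step_zero13, cfThirtyFiveStep] using h q 0

/-- expression (left side) of `cfThirtyFive_step_zero14`. -/
def cfThirtyFiveEcfThirtyFive_step_zero14 : PExpr := (.comp cfThirtyFiveStepData .va (.const (14)))

/-- expression (right side) of `cfThirtyFive_step_zero14`. -/
def cfThirtyFiveFcfThirtyFive_step_zero14 : PExpr := (.leaf [])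

set_option maxHeartbeats 4000000 in
/-- The defect vanishes identically at `m = 14`. -/
lemma cfThirtyFive_step_zero14 (q : ℚ) : cfThirtyFiveStep q 14 = 0 := by
  have h := pitE 255 1 cfThirtyFiveEcfThirtyFive_step_zero14 cfThirtyFiveFcfThirtyFive_step_zero14 (by decide +kernel) (by decide +kernel) (by decide +kernel) (by decide +kernel)
  simpa [evalE, evalP, cfThirtyFiveEcfThirtyFive_step_zero14, cfThirtyFiveFcfThirtyFive_step_zero14, cfThirtyFiveStep] using h q 0

/-- expression (left side) of `cfThirtyFive_step_zero15`. -/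
def cfThirtyFiveEcfThirtyFive_step_zero15 : PExpr := (.comp cfThirtyFiveStepData .va (.const (15)))

/-- expression (right side) of `cfThirtyFive_step_zero15`. -/
def cfThirtyFiveFcfThirtyFive_step_zero15 : PExpr := (.leaf [])

set_option maxHeartbeats 4000000 in
/-- The defect vanishes identically at `m = 15`. -/
lemma cfThirtyFive_step_zero15 (q : ℚ) : cfThirtyFiveStep q 15 = 0 := by
  have h := pitE 258 1 cfThirtyFiveEcfThirtyFive_step_zero15 cfThirtyFiveFcfThirtyFive_step_zero15 (by decide +kernel) (by decide +kernel) (by decide +kernel) (by decide +kernel)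
  simpa [evalE, evalP, cfThirtyFiveEcfThirtyFive_step_zero15, cfThirtyFiveFcfThirtyFive_step_zero15, cfThirtyFiveStep] using h q 0

/-- The defect vanishes for every `m < 16`. -/
lemma cfThirtyFive_step_small (q : ℚ) (m : ℕ) (hm : m < 16) : cfThirtyFiveStep q m = 0 := by
  interval_cases m
  · exact_mod_cast cfThirtyFive_step_zero0 q
  · exact_mod_cast cfThirtyFive_step_zero1 q
  · exact_mod_cast cfThirtyFive_step_zero2 q
  · exact_mod_cast cfThirtyFive_step_zero3 q
  · exact_mod_cast cfThirtyFive_step_zero4 q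
  · exact_mod_cast cfThirtyFive_step_zero5 q
  · exact_mod_cast cfThirtyFive_step_zero6 q
  · exact_mod_cast cfThirtyFive_step_zero7 q
  · exact_mod_cast cfThirtyFive_step_zero8 q
  · exact_mod_cast cfThirtyFive_step_zero9 q
  · exact_mod_cast cfThirtyFive_step_zero10 q
  · exact_mod_cast cfThirtyFive_step_zero11 q
  · exact_mod_cast cfThirtyFive_step_zero12 q
  · exact_mod_cast cfThirtyFive_step_zero13 q
  · exact_mod_cast cfThirtyFive_step_zero14 q
  · exact_mod_cast cfThirtyFive_step_zero15 q

/-- `C_35` is a sub-solution of the recurrence (`m + 1 ≤ q`). -/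
lemma cfThirtyFive_step (q : ℚ) (m : ℕ) (hq : (m : ℚ) + 1 ≤ q) :
    (q + m + 1) * cfThirtyFiveN q (m + 1) * cfThirtyFiveD q m
      ≤ (2 * (m + 1) * cfThirtyFiveN q m + q * cfThirtyFiveD q m) * cfThirtyFiveD q (m + 1) := by
  have e := cfThirtyFive_step_eq q m
  rcases Nat.lt_or_ge m 16 with h | h
  · rw [cfThirtyFive_step_small q m h] at e
    linarith
  · have key := cfThirtyFive_step_shift (q - m - 1) ((m : ℚ) - 16)
    rw [show q - m - 1 + ((m : ℚ) - 16) + 17 = q by ring, show (m : ℚ) - 16 + 16 = m by ring] at key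
    have ht : (16 : ℚ) ≤ m := by exact_mod_cast h
    have hpos := evalP_nonneg cfThirtyFiveStepAb (by decide +kernel) (q - m - 1) ((m : ℚ) - 16) (by linarith) (by linarith)
    linarith

/-- **The lower bound**: `C_35(q,m) ≤ S(q,m)` for `m + 1 ≤ q`. -/
theorem cfThirtyFive_le_sumS (q m : ℕ) (hmq : m + 1 ≤ q) :
    cfThirtyFiveN q m / cfThirtyFiveD q m ≤ sumS q m := by
  induction m with
  | zero =>
    rw [sumS_zero, Nat.cast_zero, cfThirtyFive_zero]
    have hD := cfThirtyFiveD_pos q 0 le_rfl (by exact_mod_cast hmq)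
    rw [div_self hD.ne']
  | succ m ih =>
    have ih' := ih (by omega)
    have hD := cfThirtyFiveD_pos q m (by positivity) (by exact_mod_cast (show m + 1 ≤ q by omega))
    have hD' := cfThirtyFiveD_pos q (m + 1) (by positivity) (by exact_mod_cast hmq)
    have hrec := sumS_succ q m
    have hstep := cfThirtyFive_step q m (by exact_mod_cast (show m + 1 ≤ q by omega))
    have hqm : (0 : ℚ) < q + m + 1 := by positivity
    rw [div_le_iff₀ hD] at ih'
    push_cast
    rw [div_le_iff₀ hD']
    have hS : sumS q (m + 1) = (2 * (m + 1) * sumS q m + q) / (q + m + 1) := by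
      rw [eq_div_iff hqm.ne']; linarith
    rw [hS, div_mul_eq_mul_div, le_div_iff₀ hqm]
    have h4 : 0 ≤ 2 * ((m : ℚ) + 1) * cfThirtyFiveD q (m + 1) * (sumS q m * cfThirtyFiveD q m - cfThirtyFiveN q m) :=
      mul_nonneg (by positivity) (by linarith)
    have h5 : cfThirtyFiveD q m * (cfThirtyFiveN q (m + 1) * (q + m + 1))
        ≤ cfThirtyFiveD q m * ((2 * (m + 1) * sumS q m + q) * cfThirtyFiveD q (m + 1)) := by
      nlinarith [hstep, h4]
    exact le_of_mul_le_mul_left h5 hD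

end PercRepro
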